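/-
Copyright (c) 2026 the pub-hodgecm-mathlib formalisation cell (harness21).  Prover seat hodgecm-mathlib-K2E3-p25 (g2), HCML Track B «K2-LIT»,
h413 = `stmt-HodgeConjecture-24833`, road (11-3-split-nsc), leaf (nsc-S-A′) `sig_K2E3GL3PrincipalBlockStandardSpan` (U12 :463), brick (E4b-T, concrete half; dealer D104):
the weak cell lemma for `P_{(1,2)}` from the weak cell lemma for `P_{(2,1)}` along `θ(g) = w₀ ᵗg⁻¹ w₀`.  2026-09-04.
-/
import Summits.HodgeConjecture.HodgeConjecture.Theorems.K2E3JacquetModuleAutomorphismTransport   -- ★ E4b-T generic (this seat): `ncq_jacquetGL_parabolicIndGL_of_involution`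
import HarnessLib

/-!
# K2_E3 road (h413), leaf (nsc-S-A′), brick E4b-T (concrete half) — `h3cell` for `c = ![0,1,1]` from `h3cell` for `c = ![0,0,1]`

Cell `pub/hodgecm-mathlib` (D-0151), Track B, seat K2E3-p25 (g2) (leaf owner ∕ architect).  `--supports stmt-HodgeConjecture-24833 --as helper`; THEOREMS ONLY
(no `def`, no instance, no notation, no `sorry`); never imports `Cruxes/…/Lines`.  COUNT-NEUTRAL.

THE MATHEMATICS ([Zelevinsky1980, §1.1]; [BernsteinZelevinsky1977, §2.3]; [Bump1997, §4.4]).  The continuous involution `θ(g) = w₀ ᵗg⁻¹ w₀` of `GL₃(F)` (★ `gkAutomorphism`)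
preserves the Borel `B` and its unipotent radical (§1: `gkAutomorphism_mem_borel_iff`, `gkAutomorphism_mem_unipotentRadical_borel`), exchanges `P_{(1,2)} ↔ P_{(2,1)}` with
their radicals (★ T1 §3), and carries the principal series `I(χ) = i_B(𝟙·χ)` to `I(χ ∘ e_B)` (`f ↦ f ∘ θ⁻¹`).  Every one-dimensional representation of the torus on `ℂ` is a
`𝟙.twist χ'` (§1: `exists_eq_trivial_twist`).  Hence (§2, HEAD) **`ncq_jacquetGL_oneTwo_of_twoOne`**: if for EVERY torus character `χ'` no `M_{(2,1)}`-subrepresentation of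
`r_{(2,1)} I(χ')` maps non-trivially to an irreducible smooth supercuspidal representation on `W` (★ E4a's `h3cell` at `c = ![0,0,1]`, bricks E4b-1∕2∕3), then the same
holds at `c = ![0,1,1]` for every `χ` — ★ `ncq_jacquetGL_parabolicIndGL_of_involution` with `(c, c', d, d') = (![0,1,1], ![0,0,1], id, id)`.

HONEST LABEL: HC_CM is proved only modulo the 7 printed citations (2 remaining named inputs: hLiu418 = stmt-HodgeConjecture-24832, h413 = stmt-HodgeConjecture-24833) until rung 0
closes; count-neutral helper.

## References
* [Zelevinsky1980] A. V. Zelevinsky, *Induced representations of reductive p-adic groups II*, Ann. Sci. ÉNS 13 (1980), §1.1.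
* [BernsteinZelevinsky1977] I. N. Bernstein, A. V. Zelevinsky, *Induced representations of reductive p-adic groups I*, Ann. Sci. ÉNS 10 (1977), §2.3.
* [Bump1997] D. Bump, *Automorphic Forms and Representations* (1997), §4.4 p. 455.
-/

set_option autoImplicit false
set_option linter.dupNamespace false

noncomputable section

open Function Representation
open scoped MatrixGroups
open Literature.NumberTheory.Automorphic
open Summit.HodgeConjecture.HodgeConjecture.Cruxes.H413.K2E3GL3OuterAutomorphismInduction
open Summit.HodgeConjecture.HodgeConjecture.Cruxes.H413.K2E3JacquetModuleAutomorphismTransport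

namespace Summit.HodgeConjecture.HodgeConjecture.Cruxes.H413.K2E3GL3WeakCellLemmaTransport

variable (F : Type) [Field F] [ValuativeRel F] [TopologicalSpace F] [IsNonarchimedeanLocalField F]

/-! ## §1 `θ(B) = B`, `θ(U_B) = U_B`; one-dimensional representations are twists of `𝟙` -/

/-- **`θ(B) = B`**: `θ x` is upper triangular iff `x` is (entries of `θ x` are entries of `x⁻¹` reflected in the antidiagonal; `B` is closed under inversion).
[cite: Zelevinsky1980, §1.1] -/
theorem gkAutomorphism_mem_borel_iff (x : GL (Fin 3) F) :
    gkAutomorphism x ∈ standardParabolicGL F (id : Fin 3 → Fin 3) ↔ x ∈ standardParabolicGL F (id : Fin 3 → Fin 3) := by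
  have hrel : ∀ i j : Fin 3, (id : Fin 3 → Fin 3) j < id i → (id : Fin 3 → Fin 3) i.rev < id j.rev := by decide
  constructor
  · intro h
    rw [← (standardParabolicGL F (id : Fin 3 → Fin 3)).inv_mem_iff (x := x), mem_standardParabolicGL_iff]
    rw [mem_standardParabolicGL_iff] at h
    intro i j hij
    have h' := h (hrel i j hij)
    rwa [coe_gkAutomorphism_apply, Fin.rev_rev, Fin.rev_rev] at h'
  · intro h
    rw [← (standardParabolicGL F (id : Fin 3 → Fin 3)).inv_mem_iff (x := x), mem_standardParabolicGL_iff] at h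
    rw [mem_standardParabolicGL_iff]
    intro i j hij
    rw [coe_gkAutomorphism_apply]
    exact h (hrel i j hij)

/-- **`θ(U_B) ⊆ U_B`** (entrywise from `x⁻¹ ∈ U_B`). [cite: Zelevinsky1980, §1.1] -/
theorem gkAutomorphism_mem_unipotentRadical_borel {x : GL (Fin 3) F} (hx : x ∈ unipotentRadicalGL F (id : Fin 3 → Fin 3)) :
    gkAutomorphism x ∈ unipotentRadicalGL F (id : Fin 3 → Fin 3) := by
  have hrel : ∀ i j : Fin 3, (id : Fin 3 → Fin 3) j < id i → (id : Fin 3 → Fin 3) i.rev < id j.rev := by decide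
  have heq : ∀ i j : Fin 3, (id : Fin 3 → Fin 3) i = id j → (id : Fin 3 → Fin 3) j.rev = id i.rev := by decide
  have hy := (unipotentRadicalGL F (id : Fin 3 → Fin 3)).inv_mem hx
  refine mem_unipotentRadicalGL_of_apply _ (fun i j hij => ?_) (fun i j hij => ?_)
  · rw [coe_gkAutomorphism_apply]
    exact (unipotentRadicalGL_le F _ hy) (hrel i j hij)
  · rw [coe_gkAutomorphism_apply, apply_eq_of_mem_unipotentRadicalGL _ hy j.rev i.rev (heq i j hij)]
    by_cases hij' : i = j
    · subst hij'; rw [if_pos rfl, if_pos rfl]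
    · rw [if_neg hij', if_neg fun h' => hij' (Fin.rev_injective h').symm]

omit [ValuativeRel F] [TopologicalSpace F] [IsNonarchimedeanLocalField F] in
/-- **A representation on the line `ℂ` is `𝟙.twist χ'`** for the character `χ'(g) = τ(g)(1)`. [folklore] -/
theorem exists_eq_trivial_twist {G : Type*} [Group G] (τ : Representation ℂ G ℂ) :
    ∃ χ' : G →* ℂˣ, τ = (Representation.trivial ℂ G ℂ).twist χ' := by
  have hmul : ∀ g h : G, τ (g * h) 1 = τ g 1 * τ h 1 := fun g h => by
    rw [map_mul, Module.End.mul_apply]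
    conv_lhs => rw [show τ h 1 = τ h 1 • (1 : ℂ) by rw [smul_eq_mul, mul_one], map_smul, smul_eq_mul, mul_comm]
  have hone : τ 1 1 = 1 := by rw [MonoidHom.map_one τ, Module.End.one_apply]
  let χ' : G →* ℂˣ :=
    { toFun := fun g => ⟨τ g 1, τ g⁻¹ 1, by rw [← hmul, mul_inv_cancel, hone], by rw [← hmul, inv_mul_cancel, hone]⟩
      map_one' := Units.ext hone
      map_mul' := fun g h => Units.ext (hmul g h) }
  refine ⟨χ', ?_⟩
  ext g
  rw [Representation.twist_apply, Representation.trivial_apply, smul_eq_mul, mul_one]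
  rfl

/-! ## §2 The head -/

/-- **THE WEAK CELL LEMMA FOR `P_{(1,2)}` FROM THE WEAK CELL LEMMA FOR `P_{(2,1)}`.**  If for every torus character `χ'` no `M_{![0,0,1]}`-subrepresentation of
`r_{![0,0,1]}(I χ')` admits a non-zero map to an irreducible smooth supercuspidal representation on `W`, then for every torus character `χ` no `M_{![0,1,1]}`-subrepresentation
of `r_{![0,1,1]}(I χ)` does — transport along `θ = gkAutomorphism` (★ `ncq_jacquetGL_parabolicIndGL_of_involution`, ★ T1 §3, §1).
[cite: Zelevinsky1980, §1.1] [cite: BernsteinZelevinsky1977, §2.3] -/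
theorem ncq_jacquetGL_oneTwo_of_twoOne {W : Type*} [AddCommGroup W] [Module ℂ W]
    (h : ∀ (χ' : (Π a : Fin 3, GL {i : Fin 3 // (id : Fin 3 → Fin 3) i = a} F) →* ℂˣ)
      (σ' : Representation ℂ (Π b, GL {i // (![0, 0, 1] : Fin 3 → Fin 2) i = b} F) W), σ'.IsIrreducible → σ'.IsSmooth → σ'.IsSupercuspidal →
      ∀ (N' : Subrepresentation (jacquetGL F (![0, 0, 1] : Fin 3 → Fin 2) (parabolicIndGL F (id : Fin 3 → Fin 3)
          ((Representation.trivial ℂ (Π a : Fin 3, GL {i : Fin 3 // (id : Fin 3 → Fin 3) i = a} F) ℂ).twist χ'))))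
        (q' : N'.toRepresentation.IntertwiningMap σ'), q' = 0)
    (χ : (Π a : Fin 3, GL {i : Fin 3 // (id : Fin 3 → Fin 3) i = a} F) →* ℂˣ)
    (σ : Representation ℂ (Π a, GL {i // (![0, 1, 1] : Fin 3 → Fin 2) i = a} F) W) [σ.IsIrreducible] (hσ : σ.IsSmooth) (hsc : σ.IsSupercuspidal)
    (N : Subrepresentation (jacquetGL F (![0, 1, 1] : Fin 3 → Fin 2) (parabolicIndGL F (id : Fin 3 → Fin 3)
      ((Representation.trivial ℂ (Π a : Fin 3, GL {i : Fin 3 // (id : Fin 3 → Fin 3) i = a} F) ℂ).twist χ))))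
    (q : N.toRepresentation.IntertwiningMap σ) : q = 0 := by
  refine ncq_jacquetGL_parabolicIndGL_of_involution F (![0, 1, 1] : Fin 3 → Fin 2) (![0, 0, 1] : Fin 3 → Fin 2) (id : Fin 3 → Fin 3) (id : Fin 3 → Fin 3)
    gkAutomorphism (gkAutomorphism_gkAutomorphism F) (gkAutomorphism_mem_parabolic_two_one_iff F) (gkAutomorphism_mem_parabolic_one_two_iff F)
    (fun _ hp => (mem_unipotentRadicalP_iff F _ _).2 (gkAutomorphism_mem_unipotentRadical_two_one F ((mem_unipotentRadicalP_iff F _ _).1 hp)))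
    (fun _ hp => (mem_unipotentRadicalP_iff F _ _).2 (gkAutomorphism_mem_unipotentRadical_one_two F ((mem_unipotentRadicalP_iff F _ _).1 hp)))
    (gkAutomorphism_mem_borel_iff F) (gkAutomorphism_mem_borel_iff F)
    (fun _ hp => (mem_unipotentRadicalP_iff F _ _).2 (gkAutomorphism_mem_unipotentRadical_borel F ((mem_unipotentRadicalP_iff F _ _).1 hp)))
    (fun τ' σ' hirr' hsm' hsc' N' q' => ?_) ((Representation.trivial ℂ _ ℂ).twist χ) σ hσ hsc N q
  obtain ⟨χ', rfl⟩ := exists_eq_trivial_twist τ'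
  exact h χ' σ' hirr' hsm' hsc' N' q'

end Summit.HodgeConjecture.HodgeConjecture.Cruxes.H413.K2E3GL3WeakCellLemmaTransport

end
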